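import Mathlib
import HarnessLib
import Summits.ValiantsHypothesis.ValiantsHypothesis.Theorems.MonotoneRestorationOrbitRestorationLinearVolumeQPPolylogTreewidthFloor

/-!
# R1 (`OrbitRestorationLinearVolumeQP`, stmt-ValiantsHypothesis-18294): the one-sided floor —
# patterns with ONE side of polylogarithmic size, the other side arbitrary (linear volume allowed)

Route MonotoneRestoration, aside R1 (line `birth`; after K2/K3, `…LinearVolumeQPBirthStubs.lean`, the item rests on
`stub_lvNarrowSpan` alone).  The landed polylog-treewidth floor (`PolylogTreewidthFloor.orbitRestoration_of_polylogTreewidth`)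
gives R1's conclusion, VP-free, for pattern families of treewidth `≤ (log₂ n + c)^c`.  This file adds the
elementary graph fact that the pattern graph of a bipartite multigraph `(Fin a ⊔ Fin b, E)` has treewidth
`≤ min a b` (path decomposition whose `j`-th bag is the whole small side plus the `j`-th vertex of the other
side), and records the resulting UNBALANCED sub-rung of R1 in the item's own currency:

* `treewidth_pattern_le_left` / `treewidth_pattern_le_right` / `treewidth_pattern_le_min` — `tw ≤ a`, `tw ≤ b`
  (the pattern graph is spelled out inline, as in the line's statements; no definition is introduced);
* `orbitRestoration_of_oneSidedPolylog` — a family that is, level by level, ANY finite combination of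
  homomorphism polynomials of bipartite patterns with `min (a n i) (b n i) ≤ (log₂ n + c)^c` (one side polylog,
  the other side of any size — in particular of linear volume `a + b ≤ c (n+1)`, any dimension, no `VP`
  hypothesis) has square-symmetric circuits of orbit size `≤ 2^((log₂ n + c + 3)^(c+3))`;
* `orbitRestorationLinearVolumeQP_oneSided` — the same phrased as the R1-class restricted to unbalanced patterns
  (hypotheses of `OrbitRestorationLinearVolumeQP` verbatim plus the one-sidedness clause; `IsVPFamily` unused).

Examples covered: complete bipartite patterns `K_{s,t}` with `s` polylog and `t` linear (products of power sums
of column sums), stars and double stars with polylog centres, every pattern all of whose edges meet a polylog set of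
rows.  Honest framing: a VP-free sub-rung strictly inside the treewidth floor's reach (it only identifies a graph
class of polylog treewidth by its side sizes); R1's open core — balanced linear-volume patterns of
super-polylogarithmic treewidth, where `VP` must be used — is untouched, as are the crux and VP ≠ VNP.
-/

noncomputable section

open MvPolynomial

-- `Summit.ValiantsHypothesis.ValiantsHypothesis.…` is the tree's single-conjunct layout (Sub = Summit).
set_option linter.dupNamespace false

namespace Summit.ValiantsHypothesis.ValiantsHypothesis.Theorems

namespace OneSidedFloor

open Literature.Computability.AlgebraicComplexity Literature.Combinatorics.SimpleGraph

/-- Every edge of the pattern graph joins a row vertex `inl i` to a column vertex `inr j`. [folklore] -/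
theorem patternGraph_adj_iff {a b : ℕ} {E : Multiset (Fin a × Fin b)} {u v : Fin a ⊕ Fin b}
    (h : (SimpleGraph.fromRel fun u v : Fin a ⊕ Fin b =>
      ∃ e ∈ E, u = Sum.inl e.1 ∧ v = Sum.inr e.2).Adj u v) :
    ∃ i j, (u = Sum.inl i ∧ v = Sum.inr j) ∨ (u = Sum.inr j ∧ v = Sum.inl i) := by
  rw [SimpleGraph.fromRel_adj] at h
  obtain ⟨-, ⟨e, -, hu, hv⟩ | ⟨e, -, hv, hu⟩⟩ := h
  · exact ⟨e.1, e.2, Or.inl ⟨hu, hv⟩⟩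
  · exact ⟨e.1, e.2, Or.inr ⟨hu, hv⟩⟩

/-- **`tw ≤ a`**: the pattern graph of a bipartite multigraph on `Fin a ⊔ Fin b` has treewidth at most the
number `a` of row vertices — the bags `(all rows) ∪ {column j}`, `j < b`, form a path decomposition of width
`a` (for `b = 0` the graph has `a` vertices and treewidth `≤ a - 1`). [folklore] -/
theorem treewidth_pattern_le_left (a b : ℕ) (E : Multiset (Fin a × Fin b)) :
    treewidth (SimpleGraph.fromRel fun u v : Fin a ⊕ Fin b =>
      ∃ e ∈ E, u = Sum.inl e.1 ∧ v = Sum.inr e.2) ≤ a := by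
  classical
  rcases Nat.eq_zero_or_pos b with rfl | hb
  · exact (treewidth_le_card_sub_one _).trans (by simp)
  · obtain ⟨k, rfl⟩ : ∃ k, b = k + 1 := ⟨b - 1, by omega⟩
    -- bags: all row vertices plus the `j`-th column vertex
    refine treewidth_le_of_intervals _
      (fun j : Fin (k + 1) => insert (Sum.inr j) (Finset.univ.image Sum.inl)) ?_ ?_ ?_ ?_
    · intro u v huv
      obtain ⟨i, j, ⟨rfl, rfl⟩ | ⟨rfl, rfl⟩⟩ := patternGraph_adj_iff huv
      · exact ⟨j, by simp, by simp⟩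
      · exact ⟨j, by simp, by simp⟩
    · rintro (i | j)
      · exact ⟨0, by simp⟩
      · exact ⟨j, by simp⟩
    · rintro (i | j)
      · have : {t : Fin (k + 1) | (Sum.inl i : Fin a ⊕ Fin (k + 1)) ∈
            insert (Sum.inr t) (Finset.univ.image Sum.inl)} = Set.univ := by
          ext t; simp
        rw [this]
        exact Set.ordConnected_univ
      · have : {t : Fin (k + 1) | (Sum.inr j : Fin a ⊕ Fin (k + 1)) ∈
            insert (Sum.inr t) (Finset.univ.image Sum.inl)} = {j} := by
          ext t; simp [eq_comm]
        rw [this]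
        exact Set.ordConnected_singleton
    · intro t
      rw [Finset.card_insert_of_notMem (by simp)]
      simp [Finset.card_image_of_injective _ Sum.inl_injective]

/-- **`tw ≤ b`**: symmetrically, the treewidth is at most the number `b` of column vertices (bags
`{row i} ∪ (all columns)`, `i < a`). [folklore] -/
theorem treewidth_pattern_le_right (a b : ℕ) (E : Multiset (Fin a × Fin b)) :
    treewidth (SimpleGraph.fromRel fun u v : Fin a ⊕ Fin b =>
      ∃ e ∈ E, u = Sum.inl e.1 ∧ v = Sum.inr e.2) ≤ b := by
  classical
  rcases Nat.eq_zero_or_pos a with rfl | ha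
  · exact (treewidth_le_card_sub_one _).trans (by simp)
  · obtain ⟨k, rfl⟩ : ∃ k, a = k + 1 := ⟨a - 1, by omega⟩
    refine treewidth_le_of_intervals _
      (fun i : Fin (k + 1) => insert (Sum.inl i) (Finset.univ.image Sum.inr)) ?_ ?_ ?_ ?_
    · intro u v huv
      obtain ⟨i, j, ⟨rfl, rfl⟩ | ⟨rfl, rfl⟩⟩ := patternGraph_adj_iff huv
      · exact ⟨i, by simp, by simp⟩
      · exact ⟨i, by simp, by simp⟩
    · rintro (i | j)
      · exact ⟨i, by simp⟩
      · exact ⟨0, by simp⟩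
    · rintro (i | j)
      · have : {t : Fin (k + 1) | (Sum.inl i : Fin (k + 1) ⊕ Fin b) ∈
            insert (Sum.inl t) (Finset.univ.image Sum.inr)} = {i} := by
          ext t; simp [eq_comm]
        rw [this]
        exact Set.ordConnected_singleton
      · have : {t : Fin (k + 1) | (Sum.inr j : Fin (k + 1) ⊕ Fin b) ∈
            insert (Sum.inl t) (Finset.univ.image Sum.inr)} = Set.univ := by
          ext t; simp
        rw [this]
        exact Set.ordConnected_univ
    · intro t
      rw [Finset.card_insert_of_notMem (by simp)]
      simp [Finset.card_image_of_injective _ Sum.inr_injective]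

/-- **`tw ≤ min a b`** for the pattern graph of a bipartite multigraph on `Fin a ⊔ Fin b`. [folklore] -/
theorem treewidth_pattern_le_min (a b : ℕ) (E : Multiset (Fin a × Fin b)) :
    treewidth (SimpleGraph.fromRel fun u v : Fin a ⊕ Fin b =>
      ∃ e ∈ E, u = Sum.inl e.1 ∧ v = Sum.inr e.2) ≤ min a b :=
  le_min (treewidth_pattern_le_left a b E) (treewidth_pattern_le_right a b E)

/-- **The one-sided floor of R1** (VP-free, dimension-free, volume-free): a family that is, at every level `n`, a
finite combination of homomorphism polynomials of bipartite multigraph patterns ONE OF WHOSE SIDES has size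
`≤ (log₂ n + c)^c` has square-symmetric circuits of orbit size `≤ 2^((log₂ n + c + 3)^(c + 3))` — such patterns
have treewidth `≤ (log₂ n + c)^c` (`treewidth_pattern_le_min`) and the polylog-treewidth floor applies.
[cite: DawarPagoSeppelt2025, §5 (proof of Thm 5.3)] -/
theorem orbitRestoration_of_oneSidedPolylog (f : (n : ℕ) → MvPolynomial (Fin n × Fin n) ℂ) (c : ℕ)
    (m : ℕ → ℕ) (a b : (n : ℕ) → Fin (m n) → ℕ)
    (E : (n : ℕ) → (i : Fin (m n)) → Multiset (Fin (a n i) × Fin (b n i))) (α : (n : ℕ) → Fin (m n) → ℂ)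
    (hside : ∀ n i, min (a n i) (b n i) ≤ (Nat.log 2 n + c) ^ c)
    (hf : ∀ n, f n = ∑ i : Fin (m n), MvPolynomial.C (α n i) * homPoly (E n i) n ℂ) :
    ∀ n : ℕ, ∃ (G : Type) (_ : Fintype G) (C : LabelledArithCircuit ℂ (Fin n × Fin n) Unit G),
      C.IsSymmetric (Equiv.Perm (Fin n)) ∧ C.eval (C.output ()) = f n ∧
        C.orbitSize (Equiv.Perm (Fin n)) ≤ 2 ^ ((Nat.log 2 n + (c + 3)) ^ (c + 3)) :=
  PolylogTreewidthFloor.orbitRestoration_of_polylogTreewidth f c m a b E α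
    (fun n i => (treewidth_pattern_le_min (a n i) (b n i) (E n i)).trans (hside n i)) hf

/-- **R1 restricted to unbalanced patterns holds** (hypotheses of `OrbitRestorationLinearVolumeQP` verbatim —
`VP`, dimension `≤ (n+2)^c`, volume `≤ c (n+1)` — plus the clause that one side of each pattern has size
`≤ (log₂ n + c)^c`; only the last clause and the representation are used).  The open core of R1 is thereby
located: BALANCED linear-volume patterns (both sides super-polylogarithmic) of super-polylogarithmic treewidth.
[cite: DawarPagoSeppelt2025, §5 (proof of Thm 5.3); DwivediPagoSeppelt2026, Outlook Q3] -/
theorem orbitRestorationLinearVolumeQP_oneSided (f : (n : ℕ) → MvPolynomial (Fin n × Fin n) ℂ)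
    (_hVP : IsVPFamily f)
    (h : ∃ (c : ℕ) (m : ℕ → ℕ) (a b : (n : ℕ) → Fin (m n) → ℕ)
      (E : (n : ℕ) → (i : Fin (m n)) → Multiset (Fin (a n i) × Fin (b n i))) (α : (n : ℕ) → Fin (m n) → ℂ),
      (∀ n, m n ≤ (n + 2) ^ c) ∧ (∀ n i, a n i + b n i ≤ c * (n + 1)) ∧
      (∀ n i, min (a n i) (b n i) ≤ (Nat.log 2 n + c) ^ c) ∧
      ∀ n, f n = ∑ i : Fin (m n), MvPolynomial.C (α n i) * homPoly (E n i) n ℂ) :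
    ∃ c : ℕ, ∀ n : ℕ, ∃ (G : Type) (_ : Fintype G) (C : LabelledArithCircuit ℂ (Fin n × Fin n) Unit G),
      C.IsSymmetric (Equiv.Perm (Fin n)) ∧ C.eval (C.output ()) = f n ∧
        C.orbitSize (Equiv.Perm (Fin n)) ≤ 2 ^ ((Nat.log 2 n + c) ^ c) := by
  obtain ⟨c, m, a, b, E, α, -, -, hside, hf⟩ := h
  exact ⟨c + 3, orbitRestoration_of_oneSidedPolylog f c m a b E α hside hf⟩

end OneSidedFloor

end Summit.ValiantsHypothesis.ValiantsHypothesis.Theorems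

end
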